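import Literature.Probability.RandomPlanarGeometry.HexSAWBrickWallStripFugacityTwoWallOrder
import Literature.Probability.RandomPlanarGeometry.HexSAWSurfaceYcLimitAllY
import Literature.Probability.RandomPlanarGeometry.HexSAWSurfaceSqrtStrict
import HarnessLib

/-!
# The half-plane wall rate of honeycomb SAW by the wall potential: `β(y)² ≤ y + 6/y` for every `y ≥ 25`
# (`β(y)² ≤ y + 4/(√y − 1)` for every `y ≥ 4`), with the matching order from below `y + 1/(5y) ≤ β(y)²` (`y ≥ 2`); hence
# `μ(y) < μ_1(y,y)` for `y ≥ 25` and `μ(y) < μ_2(y,y)` for `y ≥ 400`: two attractive walls at distance one or two beat the adsorbed half-plane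

Topic `Literature/Probability/RandomPlanarGeometry` (lane «pcv-sawmu», car «HALF-PLANE WALL WINDOW», a-p5 gen 15; continues
`HexSAWBrickWallStripFugacityTwoWallOrder.lean` (the wall-potential engine `HexBW.WallPot`: `PotVals`, `potOf`, `potMin`, `vRow`, the explicit
potentials `potValsA` / `potValsB` with `potValid_A` / `potValid_B`, and the switch arithmetic `windowA_pow_lt` / `windowB_pow_lt`; the strip
theorems `stripMuY₂_self_lt_one`, `sqrt_lt_stripMuY₂_self`, `mul_pow_le_stripMuY₂_one_self_pow`, `mul_pow_le_stripMuY₂_self_pow`),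
`HexSAWSurfaceWallBridges.lean` (S1 Part I: the lower half-plane walks `Wall.hpw`, `Wall.visits` = even times on the wall row, `Wall.Cw`/`Wall.WB`,
the Fekete wall rate `Wall.wallRate y = β(y)`, `Wall.eventually_mul_pow_le_WB`, `Wall.WB_le_Cw`) and `HexSAWSurfaceYcLimitAllY.lean`
(`HV.surfaceMu y = max (β(y)) μ_ℍ = μ(y)` of BBdGDCG14 Proposition 5)).

Sources.  N. R. Beaton, M. Bousquet-Mélou, J. de Gier, H. Duminil-Copin, A. J. Guttmann, CMP 326 (2014) = arXiv:1109.0358v5, §3.1 Proposition 5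
(p. 9 l. 16: "`μ(y) ≥ max(μ, √y)`"; p. 9 l. 30 – p. 10 l. 3: the zig-zag walks and "This translates into `μ(y) ∼ √y` in our honeycomb setting",
after Rychlewski–Whittington, J. Stat. Phys. 145 (2011), for the square lattice — not held), §3.2 Proposition 6 (p. 10: `μ_T(y,z)`).  H. Duminil-Copin,
S. Smirnov, Ann. Math. 175 (2012), Theorem 1 (`μ_ℍ = √(2+√2)`).  J. M. Hammersley, G. M. Torrie, S. G. Whittington, J. Phys. A 15 (1982) 539, §2
(surface free energy by super-multiplicativity; locator PROVISIONAL — source not held, acq-10393).  I. G. Enting, I. Jensen, LNP 775 (2009), §7.4.2,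
Fig. 7.10 (brick-wall form).  N. Madras, G. Slade, *The Self-Avoiding Walk* (1993), §1.1–§1.2.

## What is proved

Namespace `…SAW.HexBW.WallPot` (engine, half-plane version): `clsH`/`potH`/`wArrH` (state classes of the lower half-plane `{Y ≤ 0}` with its
wall row `Y = 0`: wall vertex = even abscissa = vertical bond dangling up), `PotValidH` (the eleven local inequalities = the wide-strip regime of
`PotValid`, top wall only; `PotValid.toH`), `potH_step_v` / `potH_step_h` (sub-harmonicity), `h_sum_fibre_le` (the fibre of a prefix injects into the
admissible non-reversing moves), `potSumH_succ_le : potSumH (N+1) ≤ ρ · potSumH N`, `WB_le_const_mul_pow : B^w_n(y) ≤ C·ρ^n`,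
**`wallRate_le_of_potValidH : PotValidH y ρ P → β(y) ≤ ρ`** (no rate `r ∈ (ρ, β(y))` survives S1's `eventually_mul_pow_le_WB`).
Namespace `…SAW.HexBW.Wall`: `wallRate_le_of_le_sq` / `wallRate_le_of_le_sq'` (the two potentials), ★ **`wallRate_sq_le_add_div_sqrt`** —
`4 ≤ y → β(y)² ≤ y + 4/(√y − 1)`, ★★ **`wallRate_sq_le_add_six_div`** — `25 ≤ y → β(y)² ≤ y + 6/y`; `le_wallRate_sq` (`y ≤ β(y)²`),
`wallRate_sq_mem_Icc` (`β(y)² ∈ [y, y + 6/y]`, `y ≥ 25`); and the ORDER of the correction, by the forward excursion of length `6` of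
`HexSAWSurfaceSqrtStrict.lean` (`Wall.pow_add_pow_le_wallRate_pow : y⁴ + y² ≤ β(y)⁸`, imported):
★ **`add_inv_le_wallRate_sq`** — `2 ≤ y → y + 1/(5y) ≤ β(y)²`, ★ **`wallRate_sq_sub_mem_Icc`** — `25 ≤ y → β(y)² − y ∈ [1/(5y), 6/y]`:
the first correction to the entropy-free adsorbed phase is of order EXACTLY `1/y`.
Namespace `…SAW.HexBW`: `hexConnectiveConstant_lt_two`, `hexConnectiveConstant_lt_stripMuY₂_self` (`T ≥ 1`, `y ≥ 4`),
★★ **`surfaceMu_lt_stripMuY₂_one_self`** — `25 ≤ y → μ(y) < μ_1(y,y)`, ★★ **`surfaceMu_lt_stripMuY₂_two_self`** — `400 ≤ y → μ(y) < μ_2(y,y)`,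
`surfaceMu_lt_two_lt_one` — `400 ≤ y → μ(y) < μ_2(y,y) < μ_1(y,y)`; `abs_stripMuY₂_self_sq_sub_wallRate_sq_le` —
`3 ≤ T → 25 ≤ y → |μ_T(y,y)² − β(y)²| ≤ 6/y` (a second attractive wall at distance `≥ 3` moves the squared rate by at most `6/y`).

## Method and status

The tree's window for the wall rate was `√y ≤ β(y) ≤ √y/(1 − 36/√y)` for `y > 36²` (`HexSAWSurfaceSqrtAsymptotic.lean`, by the arch recursion
with the crude block count `c_m(ℍ) ≤ 3^m`); the lane's HOME car «WALL-RATE SHARP WINDOW» had `β(y)² ≤ y + 972/y`.  The wall potential of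
`…TwoWallOrder.lean` replaces the block count by a state-by-state super-solution of the non-backtracking relaxation and gives the constant `6`
(the relaxation itself has `(ρ² − y)·y → 4`; numerically `4.22, 4.14, 4.06, 4.004` at `y = 4, 25, 64, 1024`), for every `y ≥ 25`, with a proof
that never looks beyond the first two rows.  Consequences: the lane's «TWO-WALL ATTRACTIVE WIDTH ONE» (`μ(y) < μ_1(y,y)`, HOME, `y ≥ 256`) and
«WIDTH TWO» (`y ≥ 2²⁴`) now hold from `y = 25` and `y = 400` and rest on tree files only.  Label (author's proposal, lane «pcv-sawmu»): the windows
= CONSOLIDATION WITH PROOF and explicit rate of the printed-without-proof remark "`μ(y) ∼ √y`" (BBdGDCG14 p. 10, after RW11), sharper than the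
tree's, NEW-IN-WRITING (modest) as explicit two-sided windows (`y ≤ β(y)² ≤ y + 6/y`); the comparisons `μ(y) < μ_1(y,y)`, `μ(y) < μ_2(y,y)` =
NEW-IN-WRITING (modest, S), PROVISIONAL on JvROOW05 / AJvRSW08 (two attractive walls; not held) as for the whole two-wall family.  NOT claimed:
`μ(y) < μ_T(y,y)` for `T ≥ 3` (true order of the gain `y^{(3−2T)/2}` against the common `1/y` excursion term is beyond the relaxation), anything
below `y = 25` for the `6/y` window, sharpness of `6` (the relaxation constant is `4`; the true second-order coefficient of `β(y)²` is not identified).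
-/

noncomputable section

open Filter Topology Finset Literature.Probability.LatticeModels Literature.Probability.Percolation SimpleGraph

namespace Literature.Probability.RandomPlanarGeometry.SAW.HexBW

namespace WallPot

variable {y ρ : ℝ} {P : PotVals}

/-! ### §1 The wall potential of the half-plane `{Y ≤ 0}` below its wall row `Y = 0` -/

/-- The state class of a site of the lower half-plane, row `r ≤ 0`, bond parity `q = (x + r) mod 2` (`q = 0`: the vertical bond goes
up): `0` = wall vertex (row `0`, bond dangling up, out of the half-plane), `1` = row `0` off the wall vertices, `2` = row `−1` with the
bond toward the wall, `3` = row `−1` with the bond away from it, `4` = bulk (`r ≤ −2`). [cite: EntingJensen2009, §7.4.2, Fig. 7.10 (vertical bonds {(x,y),(x,y+1)} with x+y even)] -/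
def clsH (r q : ℤ) : ℕ :=
  if r = 0 ∧ q = 0 then 0
  else if r = 0 then 1
  else if r = -1 ∧ q = 0 then 2
  else if r = -1 then 3
  else 4

/-- The wall potential of a state `(r, q, v)` of the half-plane. [cite: MadrasSlade1993, §1.2 (elementary counting)] -/
def potH (P : PotVals) (r q : ℤ) (v : Bool) : ℝ := potOf P (clsH r q) v

/-- The arrival weight in the half-plane: `y` on a wall vertex, `1` elsewhere. [cite: BeatonBousquetMelouDeGierDuminilCopinGuttmann2014, §3.1 (arXiv v5 p. 8: c(ω), contacts with the surface)] -/
def wArrH (y : ℝ) (r q : ℤ) : ℝ := if r = 0 ∧ q = 0 then y else 1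

/-- The local inequalities making the wall potential sub-harmonic at rate `ρ` for the non-backtracking walk of the half-plane
(the `T ≥ 4` regime of `PotValid`, top wall only). [cite: MadrasSlade1993, §1.2 (elementary counting)] -/
structure PotValidH (y ρ : ℝ) (P : PotVals) : Prop where
  /-- the fugacity is positive -/
  pos_y : 0 < y
  /-- positivity of the potential -/
  pos_a : 0 < P.a
  /-- positivity of the potential -/
  pos_b : 0 < P.b
  /-- positivity of the potential -/
  pos_c : 0 < P.c
  /-- positivity of the potential -/
  pos_d : 0 < P.d
  /-- positivity of the potential -/
  pos_e : 0 < P.e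
  /-- positivity of the potential -/
  pos_f : 0 < P.f
  /-- positivity of the potential -/
  pos_g : 0 < P.g
  /-- positivity of the potential -/
  pos_k : 0 < P.k
  /-- the rate is at least the non-backtracking branching number `2` -/
  two_le : 2 ≤ ρ
  /-- wall vertex, arrived horizontally: the straight continuation only -/
  hW : P.a ≤ ρ
  /-- wall row off the wall vertices, arrived horizontally -/
  hEh : y + P.d ≤ ρ * P.a
  /-- wall row off the wall vertices, arrived vertically -/
  hEv : 2 * y ≤ ρ * P.b
  /-- row `−1`, bond toward the wall, arrived horizontally -/
  hLth : P.e + P.b ≤ ρ * P.c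
  /-- row `−1`, bond toward the wall, arrived vertically -/
  hLtv : 2 * P.e ≤ ρ * P.d
  /-- row `−1`, bond away from the wall, arrived horizontally -/
  hLah : P.c + P.k ≤ ρ * P.e
  /-- row `−1`, bond away from the wall, arrived vertically -/
  hLav : 2 * P.c ≤ ρ * P.f
  /-- bulk, arrived horizontally, vertical step into row `−1` -/
  hMh_f : P.g + P.f ≤ ρ * P.g
  /-- bulk, arrived horizontally, vertical step into the bulk -/
  hMh_k : P.g + P.k ≤ ρ * P.g
  /-- bulk, arrived vertically -/
  hMv : 2 * P.g ≤ ρ * P.k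

/-- The potentials valid in every wide strip are valid in the half-plane. [cite: MadrasSlade1993, §1.2 (elementary counting)] -/
theorem PotValid.toH {T : ℕ} (hT : 4 ≤ T) (h : PotValid T y ρ P) : PotValidH y ρ P where
  pos_y := h.pos_y
  pos_a := h.pos_a
  pos_b := h.pos_b
  pos_c := h.pos_c
  pos_d := h.pos_d
  pos_e := h.pos_e
  pos_f := h.pos_f
  pos_g := h.pos_g
  pos_k := h.pos_k
  two_le := h.two_le
  hW := h.hW
  hEh := h.hEh
  hEv := h.hEv
  hLth := by have := h.hLth; rwa [if_neg (by omega)] at this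
  hLtv := by have := h.hLtv; rwa [if_neg (by omega)] at this
  hLah := h.hLah_k
  hLav := h.hLav
  hMh_f := h.hMh_f
  hMh_k := h.hMh_k
  hMv := h.hMv

/-- `potMin ≤ potOf` (only the positivity of `a` is used). [cite: MadrasSlade1993, §1.2 (elementary counting)] -/
theorem potMin_le_potOf' (ha : 0 < P.a) (n : ℕ) (v : Bool) : potMin P ≤ potOf P n v := by
  have h1 : potMin P ≤ 1 := min_le_left _ _
  have hA : potMin P ≤ P.a := (min_le_right _ _).trans (min_le_left _ _)
  have hb : potMin P ≤ P.b := (min_le_right _ _).trans ((min_le_right _ _).trans (min_le_left _ _))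
  have hc : potMin P ≤ P.c :=
    (min_le_right _ _).trans ((min_le_right _ _).trans ((min_le_right _ _).trans (min_le_left _ _)))
  have hd : potMin P ≤ P.d :=
    (min_le_right _ _).trans ((min_le_right _ _).trans ((min_le_right _ _).trans ((min_le_right _ _).trans (min_le_left _ _))))
  have he : potMin P ≤ P.e :=
    (min_le_right _ _).trans ((min_le_right _ _).trans ((min_le_right _ _).trans ((min_le_right _ _).trans
      ((min_le_right _ _).trans (min_le_left _ _)))))
  have hf : potMin P ≤ P.f :=
    (min_le_right _ _).trans ((min_le_right _ _).trans ((min_le_right _ _).trans ((min_le_right _ _).trans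
      ((min_le_right _ _).trans ((min_le_right _ _).trans (min_le_left _ _))))))
  have hg : potMin P ≤ P.g :=
    (min_le_right _ _).trans ((min_le_right _ _).trans ((min_le_right _ _).trans ((min_le_right _ _).trans
      ((min_le_right _ _).trans ((min_le_right _ _).trans ((min_le_right _ _).trans (min_le_left _ _)))))))
  have hk : potMin P ≤ P.k :=
    (min_le_right _ _).trans ((min_le_right _ _).trans ((min_le_right _ _).trans ((min_le_right _ _).trans
      ((min_le_right _ _).trans ((min_le_right _ _).trans ((min_le_right _ _).trans (min_le_right _ _)))))))
  rcases n with _ | _ | _ | _ | _ <;> rcases v with _ | _ <;> simp only [potOf] <;> linarith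

/-- `0 < potMin` under `PotValidH`. [cite: MadrasSlade1993, §1.2 (elementary counting)] -/
theorem potMin_pos' (hV : PotValidH y ρ P) : 0 < potMin P := by
  have := hV.pos_a; have := hV.pos_b; have := hV.pos_c; have := hV.pos_d
  have := hV.pos_e; have := hV.pos_f; have := hV.pos_g; have := hV.pos_k
  unfold potMin
  positivity

/-- `potMin ≤ potH`. [cite: MadrasSlade1993, §1.2 (elementary counting)] -/
theorem potMin_le_potH (hV : PotValidH y ρ P) (r q : ℤ) (v : Bool) : potMin P ≤ potH P r q v :=
  potMin_le_potOf' hV.pos_a _ _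

/-- `0 < potH`. [cite: MadrasSlade1993, §1.2 (elementary counting)] -/
theorem potH_pos (hV : PotValidH y ρ P) (r q : ℤ) (v : Bool) : 0 < potH P r q v :=
  (potMin_pos' hV).trans_le (potMin_le_potH hV r q v)

/-- `0 ≤ wArrH`. [cite: BeatonBousquetMelouDeGierDuminilCopinGuttmann2014, §3.1 (arXiv v5 p. 8)] -/
theorem wArrH_nonneg (hy : 0 ≤ y) (r q : ℤ) : 0 ≤ wArrH y r q := by
  unfold wArrH; split_ifs <;> first | exact hy | norm_num

/-- **Sub-harmonicity after a vertical step** (half-plane). [cite: MadrasSlade1993, §1.2 (elementary counting)] -/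
theorem potH_step_v (hV : PotValidH y ρ P) {r q : ℤ} (hr : r ≤ 0) (hq : q = 0 ∨ q = 1) :
    2 * (wArrH y r (1 - q) * potH P r (1 - q) false) ≤ ρ * potH P r q true := by
  obtain ⟨py, pa, pb, pc, pd, pe, pf, pg, pk, h2, hW, hEh, hEv, hLth, hLtv, hLah, hLav, hMhf, hMhk, hMv⟩ := hV
  have key : ∀ (n₁ n₂ : ℕ) (w : ℝ), clsH r q = n₁ → clsH r (1 - q) = n₂ → wArrH y r (1 - q) = w →
      2 * (w * potOf P n₂ false) ≤ ρ * potOf P n₁ true →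
      2 * (wArrH y r (1 - q) * potH P r (1 - q) false) ≤ ρ * potH P r q true := by
    intro n₁ n₂ w h1 h2 h3 h
    rw [potH, potH, h1, h2, h3]; exact h
  rcases hq with rfl | rfl
  · have hr' : r = 0 ∨ r = -1 ∨ r ≤ -2 := by omega
    rcases hr' with h3 | h3 | h3
    · exact key 0 1 1 (by unfold clsH; split_ifs <;> omega) (by unfold clsH; split_ifs <;> omega)
        (by unfold wArrH; split_ifs <;> first | rfl | omega) (by simp only [potOf]; nlinarith)
    · exact key 2 3 1 (by unfold clsH; split_ifs <;> omega) (by unfold clsH; split_ifs <;> omega)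
        (by unfold wArrH; split_ifs <;> first | rfl | omega) (by simp only [potOf]; linarith)
    · exact key 4 4 1 (by unfold clsH; split_ifs <;> omega) (by unfold clsH; split_ifs <;> omega)
        (by unfold wArrH; split_ifs <;> first | rfl | omega) (by simp only [potOf]; linarith)
  · have hr' : r = 0 ∨ r = -1 ∨ r ≤ -2 := by omega
    rcases hr' with h3 | h3 | h3
    · exact key 1 0 y (by unfold clsH; split_ifs <;> omega) (by unfold clsH; split_ifs <;> omega)
        (by unfold wArrH; split_ifs <;> first | rfl | omega) (by simp only [potOf]; linarith)
    · exact key 3 2 1 (by unfold clsH; split_ifs <;> omega) (by unfold clsH; split_ifs <;> omega)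
        (by unfold wArrH; split_ifs <;> first | rfl | omega) (by simp only [potOf]; linarith)
    · exact key 4 4 1 (by unfold clsH; split_ifs <;> omega) (by unfold clsH; split_ifs <;> omega)
        (by unfold wArrH; split_ifs <;> first | rfl | omega) (by simp only [potOf]; linarith)

/-- **Sub-harmonicity after a horizontal step** (half-plane): the straight continuation and the vertical step when it stays below the wall.
[cite: MadrasSlade1993, §1.2 (elementary counting)] -/
theorem potH_step_h (hV : PotValidH y ρ P) {r q : ℤ} (hr : r ≤ 0) (hq : q = 0 ∨ q = 1) :
    wArrH y r (1 - q) * potH P r (1 - q) false +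
        (if vRow r q ≤ 0 then wArrH y (vRow r q) (1 - q) * potH P (vRow r q) (1 - q) true else 0) ≤
      ρ * potH P r q false := by
  obtain ⟨py, pa, pb, pc, pd, pe, pf, pg, pk, h2, hW, hEh, hEv, hLth, hLtv, hLah, hLav, hMhf, hMhk, hMv⟩ := hV
  have keyV : ∀ (n₀ n₁ n₂ : ℕ) (w₁ w₂ : ℝ) (r' : ℤ), vRow r q = r' → r' ≤ 0 →
      clsH r q = n₀ → clsH r (1 - q) = n₁ → clsH r' (1 - q) = n₂ → wArrH y r (1 - q) = w₁ → wArrH y r' (1 - q) = w₂ →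
      w₁ * potOf P n₁ false + w₂ * potOf P n₂ true ≤ ρ * potOf P n₀ false →
      wArrH y r (1 - q) * potH P r (1 - q) false +
        (if vRow r q ≤ 0 then wArrH y (vRow r q) (1 - q) * potH P (vRow r q) (1 - q) true else 0) ≤
      ρ * potH P r q false := by
    intro n₀ n₁ n₂ w₁ w₂ r' hr' hT'' c0 c1 c2 e1 e2 h
    rw [if_pos (by rw [hr']; exact hT''), hr', potH, potH, potH, c0, c1, c2, e1, e2]; exact h
  have keyN : ∀ (n₀ n₁ : ℕ) (w₁ : ℝ), ¬ (vRow r q ≤ 0) →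
      clsH r q = n₀ → clsH r (1 - q) = n₁ → wArrH y r (1 - q) = w₁ →
      w₁ * potOf P n₁ false ≤ ρ * potOf P n₀ false →
      wArrH y r (1 - q) * potH P r (1 - q) false +
        (if vRow r q ≤ 0 then wArrH y (vRow r q) (1 - q) * potH P (vRow r q) (1 - q) true else 0) ≤
      ρ * potH P r q false := by
    intro n₀ n₁ w₁ hn c0 c1 e1 h
    rw [if_neg hn, add_zero, potH, potH, c0, c1, e1]; exact h
  rcases hq with rfl | rfl
  · -- q = 0: bond up, r' = r + 1
    have hv : vRow r 0 = r + 1 := by simp [vRow]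
    have hr' : r = 0 ∨ r = -1 ∨ r = -2 ∨ r ≤ -3 := by omega
    rcases hr' with h4 | h4 | h4 | h4
    · exact keyN 0 1 1 (by rw [hv]; omega)
        (by unfold clsH; split_ifs <;> omega) (by unfold clsH; split_ifs <;> omega)
        (by unfold wArrH; split_ifs <;> first | rfl | omega) (by simp only [potOf]; linarith)
    · exact keyV 2 3 1 1 1 (r + 1) (by rw [hv]) (by omega)
        (by unfold clsH; split_ifs <;> omega) (by unfold clsH; split_ifs <;> omega) (by unfold clsH; split_ifs <;> omega)
        (by unfold wArrH; split_ifs <;> first | rfl | omega) (by unfold wArrH; split_ifs <;> first | rfl | omega)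
        (by simp only [potOf]; linarith)
    · exact keyV 4 4 3 1 1 (r + 1) (by rw [hv]) (by omega)
        (by unfold clsH; split_ifs <;> omega) (by unfold clsH; split_ifs <;> omega) (by unfold clsH; split_ifs <;> omega)
        (by unfold wArrH; split_ifs <;> first | rfl | omega) (by unfold wArrH; split_ifs <;> first | rfl | omega)
        (by simp only [potOf]; linarith)
    · exact keyV 4 4 4 1 1 (r + 1) (by rw [hv]) (by omega)
        (by unfold clsH; split_ifs <;> omega) (by unfold clsH; split_ifs <;> omega) (by unfold clsH; split_ifs <;> omega)
        (by unfold wArrH; split_ifs <;> first | rfl | omega) (by unfold wArrH; split_ifs <;> first | rfl | omega)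
        (by simp only [potOf]; linarith)
  · -- q = 1: bond down, r' = r - 1
    have hv : vRow r 1 = r - 1 := by simp [vRow]
    have hr' : r = 0 ∨ r = -1 ∨ r ≤ -2 := by omega
    rcases hr' with h3 | h3 | h3
    · exact keyV 1 0 2 y 1 (r - 1) (by rw [hv]) (by omega)
        (by unfold clsH; split_ifs <;> omega) (by unfold clsH; split_ifs <;> omega) (by unfold clsH; split_ifs <;> omega)
        (by unfold wArrH; split_ifs <;> first | rfl | omega) (by unfold wArrH; split_ifs <;> first | rfl | omega)
        (by simp only [potOf]; linarith)
    · exact keyV 3 2 4 1 1 (r - 1) (by rw [hv]) (by omega)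
        (by unfold clsH; split_ifs <;> omega) (by unfold clsH; split_ifs <;> omega) (by unfold clsH; split_ifs <;> omega)
        (by unfold wArrH; split_ifs <;> first | rfl | omega) (by unfold wArrH; split_ifs <;> first | rfl | omega)
        (by simp only [potOf]; linarith)
    · exact keyV 4 4 4 1 1 (r - 1) (by rw [hv]) (by omega)
        (by unfold clsH; split_ifs <;> omega) (by unfold clsH; split_ifs <;> omega) (by unfold clsH; split_ifs <;> omega)
        (by unfold wArrH; split_ifs <;> first | rfl | omega) (by unfold wArrH; split_ifs <;> first | rfl | omega)
        (by simp only [potOf]; linarith)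

/-! ### §2 Half-plane walks from the origin: the last step -/

open Wall

variable {N : ℕ} {ω ω' : ℕ → Site 2}

/-- Row of the `m`-th site. [cite: MadrasSlade1993, §1.1] -/
def hRow (ω : ℕ → Site 2) (m : ℕ) : ℤ := ω m 1

/-- Bond parity `(x + r) mod 2` of the `m`-th site. [cite: EntingJensen2009, §7.4.2, Fig. 7.10] -/
def hPar (ω : ℕ → Site 2) (m : ℕ) : ℤ := (ω m 0 + ω m 1) % 2

/-- Whether the step `m → m+1` is vertical. [cite: EntingJensen2009, §7.4.2, Fig. 7.10] -/
def hVert (ω : ℕ → Site 2) (m : ℕ) : Bool := decide (ω (m + 1) 0 = ω m 0)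

/-- The prefix of length `N`. [cite: MadrasSlade1993, §1.2, eq. (1.2.3)] -/
def hpref (N : ℕ) (ω : ℕ → Site 2) : ℕ → Site 2 := fun i => ω (min i N)

/-- The prefix of a half-plane walk is a half-plane walk with the same visits up to time `N`. [cite: MadrasSlade1993, §1.2, eq. (1.2.3)] -/
theorem hpref_mem (hω : ω ∈ hpw (N + 1)) : hpref N ω ∈ hpw N ∧ visits N (hpref N ω) = visits N ω := by
  obtain ⟨hωs, hH⟩ := mem_hpw.1 hω
  obtain ⟨h0, -, hbw, hinj⟩ := mem_saws_iff.1 hωs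
  have hv : ∀ i ≤ N, hpref N ω i = ω i := fun i hi => by simp [hpref, min_eq_left hi]
  refine ⟨mem_hpw.2 ⟨mem_saws_iff.2 ⟨by rw [hv 0 (Nat.zero_le _), h0], fun i hi => by simp [hpref, min_eq_right hi],
    fun i hi => ?_, fun i hi j hj hij => ?_⟩, fun i hi => ?_⟩, visits_congr fun i _ hi => by rw [hv i hi]⟩
  · rw [hv i hi.le, hv (i + 1) (by omega)]; exact hbw i (by omega)
  · simp only [Set.mem_setOf_eq] at hi hj
    rw [hv i hi, hv j hj] at hij
    exact hinj (show i ∈ {k | k ≤ N + 1} by simp only [Set.mem_setOf_eq]; omega)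
      (show j ∈ {k | k ≤ N + 1} by simp only [Set.mem_setOf_eq]; omega) hij
  · rw [hv i hi]; exact hH i (by omega)

/-- Sites agree with those of a walk having this prefix. [cite: MadrasSlade1993, §1.2, eq. (1.2.3)] -/
theorem apply_eq_of_hpref_eq (h : hpref N ω = ω') {m : ℕ} (hm : m ≤ N) : ω m = ω' m := by
  rw [← h]; simp [hpref, min_eq_left hm]

/-- The parity is `0` or `1`. [cite: EntingJensen2009, §7.4.2, Fig. 7.10] -/
theorem hPar_cases (ω : ℕ → Site 2) (m : ℕ) : hPar ω m = 0 ∨ hPar ω m = 1 := by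
  unfold hPar; omega

/-- **The last step** in coordinates: a brick-wall bond. [cite: EntingJensen2009, §7.4.2, Fig. 7.10 (vertical bonds {(x,y),(x,y+1)} with x+y even)] -/
theorem h_last_step_coord (hω : ω ∈ hpw (N + 1)) :
    ((ω (N + 1) 0 = ω N 0 + 1 ∨ ω N 0 = ω (N + 1) 0 + 1) ∧ ω (N + 1) 1 = ω N 1) ∨
      (ω (N + 1) 0 = ω N 0 ∧
        ((ω (N + 1) 1 = ω N 1 + 1 ∧ (ω N 0 + ω N 1) % 2 = 0) ∨
          (ω N 1 = ω (N + 1) 1 + 1 ∧ (ω (N + 1) 0 + ω (N + 1) 1) % 2 = 0))) := by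
  obtain ⟨hωs, -⟩ := mem_hpw.1 hω
  obtain ⟨-, -, hbw, -⟩ := mem_saws_iff.1 hωs
  have hadj : brickWallGraph.Adj (ω N) (ω (N + 1)) := hbw N (Nat.lt_succ_self N)
  rwa [brickWallGraph_adj_coord] at hadj

/-- **The last step**: parity flips; vertical along the prescribed bond, or horizontal. [cite: EntingJensen2009, §7.4.2, Fig. 7.10] -/
theorem h_last_step (hω : ω ∈ hpw (N + 1)) :
    hPar ω (N + 1) = 1 - hPar ω N ∧
      ((hVert ω N = true ∧ hRow ω (N + 1) = vRow (hRow ω N) (hPar ω N) ∧ ω (N + 1) 0 = ω N 0) ∨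
       (hVert ω N = false ∧ hRow ω (N + 1) = hRow ω N ∧ (ω (N + 1) 0 = ω N 0 + 1 ∨ ω (N + 1) 0 = ω N 0 - 1))) := by
  have h := h_last_step_coord hω
  unfold hPar hRow hVert vRow
  simp only [decide_eq_true_eq, decide_eq_false_iff_not]
  omega

/-- In the half-plane: `row ≤ 0`. [cite: BeatonBousquetMelouDeGierDuminilCopinGuttmann2014, §3.1 (arXiv v5 p. 8)] -/
theorem hRow_le (hω : ω ∈ hpw N) {m : ℕ} (hm : m ≤ N) : hRow ω m ≤ 0 := (mem_hpw.1 hω).2 m hm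

/-- **Non-backtracking**. [cite: MadrasSlade1993, §1.2 (self-avoidance)] -/
theorem apply_add_two_ne (hω : ω ∈ hpw (N + 1 + 1)) : ω (N + 1 + 1) ≠ ω N := by
  obtain ⟨hωs, -⟩ := mem_hpw.1 hω
  obtain ⟨-, -, -, hinj⟩ := mem_saws_iff.1 hωs
  intro h
  have := hinj (show N + 1 + 1 ∈ {i | i ≤ N + 1 + 1} by simp) (show N ∈ {i | i ≤ N + 1 + 1} by simp only [Set.mem_setOf_eq]; omega) h
  omega

/-- The time parity is the bond parity of the site (the walk starts at the origin). [cite: MadrasSlade1993, §1.1] -/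
theorem hPar_eq_time (hω : ω ∈ hpw N) {m : ℕ} (hm : m ≤ N) : hPar ω m = (m : ℤ) % 2 := by
  unfold hPar; exact parity_apply (mem_hpw.1 hω).1 hm

/-- The visit count grows by the wall indicator of the new site. [cite: BeatonBousquetMelouDeGierDuminilCopinGuttmann2014, §3.1 (arXiv v5 p. 8: c(ω))] -/
theorem pow_visits_succ' (hω : ω ∈ hpw (N + 1)) (y : ℝ) :
    y ^ visits (N + 1) ω = y ^ visits N ω * wArrH y (hRow ω (N + 1)) (hPar ω (N + 1)) := by
  rw [Wall.visits_succ]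
  have hp := hPar_eq_time hω (le_refl (N + 1))
  unfold wArrH hRow hPar
  unfold hPar at hp
  push_cast at hp
  by_cases h1 : ((N + 1) % 2 = 0 ∧ ω (N + 1) 1 = 0)
  · rw [if_pos h1, if_pos (by constructor <;> omega), pow_succ]
  · rw [if_neg h1, if_neg (by omega), add_zero, mul_one]

/-- The code of the last step of a walk of length `N + 2`: `2` = vertical, `0` = to the right, `1` = to the left. [cite: EntingJensen2009, §7.4.2, Fig. 7.10] -/
def hCode (N : ℕ) (ω : ℕ → Site 2) : ℕ :=
  if hVert ω (N + 1) = true then 2 else if ω (N + 1 + 1) 0 = ω (N + 1) 0 + 1 then 0 else 1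

/-- The value bound attached to a code, seen from the state `(r, q)` at time `N + 1`. [cite: MadrasSlade1993, §1.2 (elementary counting)] -/
def hCodeVal (y : ℝ) (P : PotVals) (r q : ℤ) (c : ℕ) : ℝ :=
  if c = 2 then (if vRow r q ≤ 0 then wArrH y (vRow r q) (1 - q) * potH P (vRow r q) (1 - q) true else 0)
  else wArrH y r (1 - q) * potH P r (1 - q) false

/-- `0 ≤ hCodeVal`. [cite: MadrasSlade1993, §1.2 (elementary counting)] -/
theorem hCodeVal_nonneg (hV : PotValidH y ρ P) (r q : ℤ) (c : ℕ) : 0 ≤ hCodeVal y P r q c := by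
  have hy := hV.pos_y.le
  unfold hCodeVal
  split_ifs
  · exact mul_nonneg (wArrH_nonneg hy _ _) (potH_pos hV _ _ _).le
  · exact le_rfl
  · exact mul_nonneg (wArrH_nonneg hy _ _) (potH_pos hV _ _ _).le

/-- A walk of length `N+2` is determined by its prefix of length `N+1` and its last site. [cite: MadrasSlade1993, §1.2, eq. (1.2.3)] -/
theorem eq_of_hpref_eq_of_apply_eq {ω₁ ω₂ : ℕ → Site 2} (h₁ : ω₁ ∈ hpw (N + 1 + 1)) (h₂ : ω₂ ∈ hpw (N + 1 + 1))
    (hpre : hpref (N + 1) ω₁ = hpref (N + 1) ω₂) (hlast : ω₁ (N + 1 + 1) = ω₂ (N + 1 + 1)) : ω₁ = ω₂ := by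
  obtain ⟨hs₁, -⟩ := mem_hpw.1 h₁
  obtain ⟨hs₂, -⟩ := mem_hpw.1 h₂
  obtain ⟨-, hend₁, -, -⟩ := mem_saws_iff.1 hs₁
  obtain ⟨-, hend₂, -, -⟩ := mem_saws_iff.1 hs₂
  have hfun : ∀ i ≤ N + 1, ω₁ i = ω₂ i := fun i hi => by
    have := congrFun hpre i
    simpa [hpref, min_eq_left hi] using this
  funext i
  rcases Nat.lt_or_ge i (N + 1 + 1) with hi | hi
  · exact hfun i (by omega)
  · rw [hend₁ i hi, hend₂ i hi, hlast]

open Classical in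
/-- **The fibre inequality** for half-plane walks. [cite: MadrasSlade1993, §1.2 (elementary counting); EntingJensen2009, §7.4.2, Fig. 7.10] -/
theorem h_sum_fibre_le (hV : PotValidH y ρ P) (hω' : ω' ∈ hpw (N + 1)) :
    ∑ ω ∈ (hpw (N + 1 + 1)).filter (fun ω => hpref (N + 1) ω = ω'),
        wArrH y (hRow ω (N + 1 + 1)) (hPar ω (N + 1 + 1)) * potH P (hRow ω (N + 1 + 1)) (hPar ω (N + 1 + 1)) (hVert ω (N + 1)) ≤
      ρ * potH P (hRow ω' (N + 1)) (hPar ω' (N + 1)) (hVert ω' N) := by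
  set F := (hpw (N + 1 + 1)).filter (fun ω => hpref (N + 1) ω = ω') with hF
  set r := hRow ω' (N + 1) with hr
  set q := hPar ω' (N + 1) with hq
  have hr0 : r ≤ 0 := hRow_le hω' (le_refl (N + 1))
  have hq01 : q = 0 ∨ q = 1 := hPar_cases ω' (N + 1)
  have anat : ∀ ω ∈ F, ω ∈ hpw (N + 1 + 1) ∧ hpref (N + 1) ω = ω' ∧ hRow ω (N + 1) = r ∧ hPar ω (N + 1) = q ∧
      ω (N + 1) 0 = ω' (N + 1) 0 ∧ ω (N + 1) 1 = ω' (N + 1) 1 ∧ ω N 0 = ω' N 0 ∧ ω N 1 = ω' N 1 := by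
    intro ω hω
    obtain ⟨hωS, hpre⟩ := Finset.mem_filter.1 hω
    have e1 := apply_eq_of_hpref_eq hpre (le_refl (N + 1))
    have e0 := apply_eq_of_hpref_eq hpre (Nat.le_succ N)
    exact ⟨hωS, hpre, by rw [hr, hRow, hRow, e1], by rw [hq, hPar, hPar, e1], by rw [e1], by rw [e1], by rw [e0], by rw [e0]⟩
  have hval : ∀ ω ∈ F, wArrH y (hRow ω (N + 1 + 1)) (hPar ω (N + 1 + 1)) *
      potH P (hRow ω (N + 1 + 1)) (hPar ω (N + 1 + 1)) (hVert ω (N + 1)) = hCodeVal y P r q (hCode N ω) := by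
    intro ω hω
    obtain ⟨hωS, -, hr1, hq1, -, -, -, -⟩ := anat ω hω
    obtain ⟨hpar, hstep⟩ := h_last_step (N := N + 1) hωS
    rw [hr1] at hstep
    rw [hq1] at hstep hpar
    rcases hstep with ⟨hv, hrow, -⟩ | ⟨hv, hrow, hx⟩
    · have hc : hCode N ω = 2 := by simp [hCode, hv]
      have hin := hRow_le hωS (le_refl (N + 1 + 1))
      rw [hc, hCodeVal, if_pos rfl, hrow, if_pos (by rw [← hrow]; exact hin), hpar, hv]
    · have hc : hCode N ω ≠ 2 := by
        simp only [hCode, hv, Bool.false_eq_true, if_false]; split_ifs <;> omega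
      rw [hCodeVal, if_neg hc, hrow, hpar, hv]
  have hinj : Set.InjOn (hCode N) ↑F := by
    intro ω₁ h₁ ω₂ h₂ hc
    rw [Finset.mem_coe] at h₁ h₂
    obtain ⟨hS₁, hpre₁, -, -, hx₁, hy₁, -, -⟩ := anat ω₁ h₁
    obtain ⟨hS₂, hpre₂, -, -, hx₂, hy₂, -, -⟩ := anat ω₂ h₂
    refine eq_of_hpref_eq_of_apply_eq hS₁ hS₂ (hpre₁.trans hpre₂.symm) ?_
    have hs₁ := h_last_step_coord (N := N + 1) hS₁
    have hs₂ := h_last_step_coord (N := N + 1) hS₂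
    unfold hCode hVert at hc
    simp only [decide_eq_true_eq] at hc
    rw [site_two_eq_iff]
    split_ifs at hc <;> omega
  have hsum : ∑ ω ∈ F, wArrH y (hRow ω (N + 1 + 1)) (hPar ω (N + 1 + 1)) *
      potH P (hRow ω (N + 1 + 1)) (hPar ω (N + 1 + 1)) (hVert ω (N + 1)) = ∑ c ∈ F.image (hCode N), hCodeVal y P r q c := by
    rw [Finset.sum_image hinj]
    exact Finset.sum_congr rfl hval
  rw [hsum]
  obtain ⟨hpar', hstep'⟩ := h_last_step hω'
  have hs' := h_last_step_coord hω'
  rcases hstep' with ⟨hv', hrow', hx'⟩ | ⟨hv', hrow', hx'⟩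
  · have hsub : F.image (hCode N) ⊆ ({0, 1} : Finset ℕ) := by
      intro c hc
      obtain ⟨ω, hω, rfl⟩ := Finset.mem_image.1 hc
      obtain ⟨hωS, -, -, -, hx1, hy1, hx0, hy0⟩ := anat ω hω
      have hs := h_last_step_coord (N := N + 1) hωS
      have hne := apply_add_two_ne hωS
      rw [Ne, site_two_eq_iff] at hne
      rw [Finset.mem_insert, Finset.mem_singleton]
      unfold hCode hVert
      simp only [decide_eq_true_eq]
      split_ifs <;> omega
    refine (Finset.sum_le_sum_of_subset_of_nonneg hsub fun c _ _ => hCodeVal_nonneg hV r q c).trans ?_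
    rw [Finset.sum_pair (by norm_num), hv']
    have h := potH_step_v hV hr0 hq01
    simp only [hCodeVal, show (0:ℕ) ≠ 2 by norm_num, show (1:ℕ) ≠ 2 by norm_num, if_false]
    linarith
  · set c₀ : ℕ := if ω' (N + 1) 0 = ω' N 0 + 1 then 0 else 1 with hc₀
    have hc₀2 : c₀ ≠ 2 := by rw [hc₀]; split_ifs <;> omega
    have hsub : F.image (hCode N) ⊆ ({c₀, 2} : Finset ℕ) := by
      intro c hc
      obtain ⟨ω, hω, rfl⟩ := Finset.mem_image.1 hc
      obtain ⟨hωS, -, -, -, hx1, hy1, hx0, hy0⟩ := anat ω hω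
      have hs := h_last_step_coord (N := N + 1) hωS
      have hne := apply_add_two_ne hωS
      rw [Ne, site_two_eq_iff] at hne
      rw [Finset.mem_insert, Finset.mem_singleton, hc₀]
      unfold hCode hVert
      unfold hVert at hv'
      simp only [decide_eq_true_eq]
      simp only [decide_eq_false_iff_not] at hv'
      split_ifs <;> omega
    refine (Finset.sum_le_sum_of_subset_of_nonneg hsub fun c _ _ => hCodeVal_nonneg hV r q c).trans ?_
    rw [Finset.sum_pair hc₀2, hv']
    have h := potH_step_h hV hr0 hq01
    simp only [hCodeVal, hc₀2, if_false, if_true]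
    exact h

/-! ### §3 The potential-weighted half-plane partition function; `β(y) ≤ ρ` -/

/-- `Σ_{ω ∈ hpw (N+1)} y^{visits} · potH(state after the last step)`. [cite: BeatonBousquetMelouDeGierDuminilCopinGuttmann2014, §3.1 (arXiv v5 p. 8: the surface partition function)] -/
def potSumH (y : ℝ) (P : PotVals) (N : ℕ) : ℝ :=
  ∑ ω ∈ hpw (N + 1), y ^ visits (N + 1) ω * potH P (hRow ω (N + 1)) (hPar ω (N + 1)) (hVert ω N)

/-- `0 ≤ potSumH`. [cite: MadrasSlade1993, §1.2 (elementary counting)] -/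
theorem potSumH_nonneg (hV : PotValidH y ρ P) (N : ℕ) : 0 ≤ potSumH y P N :=
  Finset.sum_nonneg fun _ _ => mul_nonneg (pow_nonneg hV.pos_y.le _) (potH_pos hV _ _ _).le

open Classical in
/-- **One step costs at most a factor `ρ`** in the half-plane. [cite: MadrasSlade1993, §1.2 (elementary counting)] -/
theorem potSumH_succ_le (hV : PotValidH y ρ P) (N : ℕ) : potSumH y P (N + 1) ≤ ρ * potSumH y P N := by
  unfold potSumH
  have hmaps : ∀ ω ∈ hpw (N + 1 + 1), hpref (N + 1) ω ∈ hpw (N + 1) := fun ω hω => (hpref_mem hω).1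
  rw [← Finset.sum_fiberwise_of_maps_to hmaps, Finset.mul_sum]
  refine Finset.sum_le_sum fun ω' hω' => ?_
  have hfib : ∀ ω ∈ (hpw (N + 1 + 1)).filter (fun ω => hpref (N + 1) ω = ω'),
      y ^ visits (N + 1 + 1) ω * potH P (hRow ω (N + 1 + 1)) (hPar ω (N + 1 + 1)) (hVert ω (N + 1)) =
        y ^ visits (N + 1) ω' *
          (wArrH y (hRow ω (N + 1 + 1)) (hPar ω (N + 1 + 1)) * potH P (hRow ω (N + 1 + 1)) (hPar ω (N + 1 + 1)) (hVert ω (N + 1))) := by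
    intro ω hω
    obtain ⟨hωS, hpre⟩ := Finset.mem_filter.1 hω
    rw [pow_visits_succ' hωS, ← hpre, (hpref_mem hωS).2, mul_assoc]
  rw [Finset.sum_congr rfl hfib, ← Finset.mul_sum]
  have hy0 : 0 ≤ y ^ visits (N + 1) ω' := pow_nonneg hV.pos_y.le _
  calc y ^ visits (N + 1) ω' * ∑ ω ∈ (hpw (N + 1 + 1)).filter (fun ω => hpref (N + 1) ω = ω'),
          wArrH y (hRow ω (N + 1 + 1)) (hPar ω (N + 1 + 1)) * potH P (hRow ω (N + 1 + 1)) (hPar ω (N + 1 + 1)) (hVert ω (N + 1))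
      ≤ y ^ visits (N + 1) ω' * (ρ * potH P (hRow ω' (N + 1)) (hPar ω' (N + 1)) (hVert ω' N)) :=
        mul_le_mul_of_nonneg_left (h_sum_fibre_le hV hω') hy0
    _ = ρ * (y ^ visits (N + 1) ω' * potH P (hRow ω' (N + 1)) (hPar ω' (N + 1)) (hVert ω' N)) := by ring

/-- `potSumH N ≤ ρ^N · potSumH 0`. [cite: MadrasSlade1993, §1.2 (elementary counting)] -/
theorem potSumH_le_pow_mul (hV : PotValidH y ρ P) (N : ℕ) : potSumH y P N ≤ ρ ^ N * potSumH y P 0 := by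
  induction N with
  | zero => simp
  | succ N ih =>
    have hρ : 0 ≤ ρ := by linarith [hV.two_le]
    calc potSumH y P (N + 1) ≤ ρ * potSumH y P N := potSumH_succ_le hV N
      _ ≤ ρ * (ρ ^ N * potSumH y P 0) := mul_le_mul_of_nonneg_left ih hρ
      _ = ρ ^ (N + 1) * potSumH y P 0 := by ring

/-- `C^w_{N+1}(y) ≤ potSumH N / potMin`. [cite: BeatonBousquetMelouDeGierDuminilCopinGuttmann2014, §3.1 (arXiv v5 p. 8)] -/
theorem Cw_le_potSumH_div (hV : PotValidH y ρ P) (N : ℕ) : Cw (N + 1) y ≤ potSumH y P N / potMin P := by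
  have hm := potMin_pos' hV
  rw [le_div_iff₀ hm, Cw, potSumH, Finset.sum_mul]
  refine Finset.sum_le_sum fun ω _ => ?_
  exact mul_le_mul_of_nonneg_left (potMin_le_potH hV _ _ _) (pow_nonneg hV.pos_y.le _)

/-- **`B^w_n(y) ≤ C · ρ^n`** for every `n`, with `C = potSumH 0/potMin + 1`. [cite: HammersleyTorrieWhittington1982, §2 (as summarised by Beaton 2014, arXiv v3 p. 11; locator provisional)] -/
theorem WB_le_const_mul_pow (hV : PotValidH y ρ P) (n : ℕ) : WB n y ≤ (potSumH y P 0 / potMin P + 1) * ρ ^ n := by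
  have hy := hV.pos_y
  have hm := potMin_pos' hV
  have hρ1 : 1 ≤ ρ := by linarith [hV.two_le]
  have h0 := potSumH_nonneg hV 0
  have hC0 : 0 ≤ potSumH y P 0 / potMin P := div_nonneg h0 hm.le
  rcases n with _ | N
  · -- `WB 0 y ≤ 1`: the only walk of length 0 has no visit
    have h1 : WB 0 y ≤ Cw 0 y := WB_le_Cw 0 hy.le
    have h2 : Cw 0 y ≤ 1 := by
      rw [Cw]
      calc ∑ ω ∈ hpw 0, y ^ visits 0 ω = ∑ ω ∈ hpw 0, (1 : ℝ) := Finset.sum_congr rfl fun ω _ => by simp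
        _ = (hpw 0).card := by simp
        _ ≤ (saws 0).card := by exact_mod_cast Finset.card_le_card hpw_subset
        _ = 1 := by rw [card_saws, hexSawCount_zero]; simp
    rw [pow_zero, mul_one]; linarith
  · calc WB (N + 1) y ≤ Cw (N + 1) y := WB_le_Cw _ hy.le
      _ ≤ potSumH y P N / potMin P := Cw_le_potSumH_div hV N
      _ ≤ ρ ^ N * potSumH y P 0 / potMin P := div_le_div_of_nonneg_right (potSumH_le_pow_mul hV N) hm.le
      _ = potSumH y P 0 / potMin P * ρ ^ N := by ring
      _ ≤ potSumH y P 0 / potMin P * ρ ^ (N + 1) :=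
          mul_le_mul_of_nonneg_left (pow_le_pow_right₀ hρ1 (Nat.le_succ N)) hC0
      _ ≤ (potSumH y P 0 / potMin P + 1) * ρ ^ (N + 1) := by nlinarith [pow_pos (by linarith : (0:ℝ) < ρ) (N + 1)]

/-- **`β(y) ≤ ρ`** whenever the wall potential is sub-harmonic at rate `ρ` in the half-plane (via S1's `eventually_mul_pow_le_WB`:
no `r ∈ (ρ, β)` can exist). [cite: HammersleyTorrieWhittington1982, §2 (surface free energy by super-multiplicativity; locator provisional); BeatonBousquetMelouDeGierDuminilCopinGuttmann2014, §3.1 Proposition 5 (arXiv v5 p. 9)] -/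
theorem wallRate_le_of_potValidH (hV : PotValidH y ρ P) : wallRate y ≤ ρ := by
  have hy := hV.pos_y
  have hρ : 0 < ρ := by linarith [hV.two_le]
  by_contra hlt
  rw [not_le] at hlt
  -- pick `r` with `ρ < r < β`
  obtain ⟨r, hρr, hrβ⟩ := exists_between hlt
  have hr0 : 0 < r := hρ.trans hρr
  set C : ℝ := potSumH y P 0 / potMin P + 1 with hC
  have hC0 : 0 < C := by
    rw [hC]; have := div_nonneg (potSumH_nonneg hV 0) (potMin_pos' hV).le; linarith
  have hev := eventually_mul_pow_le_WB hy hr0 hrβ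
  -- `(r/ρ)^{2j} → ∞` contradicts `(r²/y) r^{2j} ≤ C ρ^{2j}`
  have hq : 1 < (r / ρ) ^ 2 := by
    have : 1 < r / ρ := (one_lt_div hρ).2 hρr
    nlinarith
  have hdiv := tendsto_pow_atTop_atTop_of_one_lt hq
  have hbig := hdiv.eventually (eventually_gt_atTop (C * y / r ^ 2))
  obtain ⟨j, hj1, hj2⟩ := (hev.and hbig).exists
  have hWB := WB_le_const_mul_pow hV (2 * j)
  have h1 : r ^ 2 / y * r ^ (2 * j) ≤ C * ρ ^ (2 * j) := hj1.trans hWB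
  have hρj : 0 < ρ ^ (2 * j) := pow_pos hρ _
  have h2 : ((r / ρ) ^ 2) ^ j = r ^ (2 * j) / ρ ^ (2 * j) := by rw [← pow_mul, div_pow, mul_comm]
  rw [h2, lt_div_iff₀ hρj] at hj2
  have h3 : r ^ 2 / y * r ^ (2 * j) ≤ C * ρ ^ (2 * j) := h1
  rw [div_mul_eq_mul_div, div_le_iff₀ hy] at h3
  have hr2 : 0 < r ^ 2 := pow_pos hr0 2
  -- h3: r² r^{2j} ≤ C ρ^{2j} y ; hj2: C y / r² · ρ^{2j} < r^{2j}
  have h4 : C * y / r ^ 2 * ρ ^ (2 * j) * r ^ 2 < r ^ (2 * j) * r ^ 2 := mul_lt_mul_of_pos_right hj2 hr2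
  have e : C * y / r ^ 2 * ρ ^ (2 * j) * r ^ 2 = C * ρ ^ (2 * j) * y := by field_simp
  rw [e] at h4
  linarith

end WallPot

open WallPot Wall

namespace Wall

variable {y : ℝ}

/-! ### §4 The half-plane windows: `β(y)² ≤ y + 4/(√y − 1)` (`y ≥ 4`) and `β(y)² ≤ y + 6/y` (`y ≥ 25`) -/

/-- **`β(y) ≤ ρ` for every rate `ρ ≥ 2` with `y + 4y/(ρ²(ρ−1)) ≤ ρ²`** (potential `potValsA`). [cite: BeatonBousquetMelouDeGierDuminilCopinGuttmann2014, §3.1 Proposition 5 (arXiv v5 p. 9; p. 10 ll. 2–3: "μ(y) ∼ √y")] -/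
theorem wallRate_le_of_le_sq (hy : 0 < y) {ρ : ℝ} (hρ : 2 ≤ ρ) (h : y + 4 * y / (ρ ^ 2 * (ρ - 1)) ≤ ρ ^ 2) : wallRate y ≤ ρ :=
  wallRate_le_of_potValidH ((potValid_A 4 hy hρ h).toH le_rfl)

/-- **`β(y) ≤ ρ` for every rate `ρ ≥ 2` with `y + 4y(ρ+2)/(ρ²(ρ³−ρ−2)) ≤ ρ²`** (potential `potValsB`). [cite: BeatonBousquetMelouDeGierDuminilCopinGuttmann2014, §3.1 Proposition 5 (arXiv v5 p. 9; p. 10 ll. 2–3: "μ(y) ∼ √y")] -/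
theorem wallRate_le_of_le_sq' (hy : 0 < y) {ρ : ℝ} (hρ : 2 ≤ ρ) (h : y + 4 * y * (ρ + 2) / (ρ ^ 2 * (ρ ^ 3 - ρ - 2)) ≤ ρ ^ 2) :
    wallRate y ≤ ρ :=
  wallRate_le_of_potValidH ((potValid_B (T := 4) (by norm_num) hy hρ h).toH le_rfl)

/-- **THE HALF-PLANE WINDOW `β(y)² ≤ y + 4/(√y − 1)` for every `y ≥ 4`** (the tree had `β(y) ≤ √y/(1 − 36/√y)` for `y > 36²` only).
[cite: BeatonBousquetMelouDeGierDuminilCopinGuttmann2014, §3.1 Proposition 5 (arXiv v5 p. 9 l. 16: μ(y) ≥ √y; p. 10 ll. 2–3: "μ(y) ∼ √y")] -/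
theorem wallRate_sq_le_add_div_sqrt (hy : 4 ≤ y) : wallRate y ^ 2 ≤ y + 4 / (Real.sqrt y - 1) := by
  have hy0 : 0 < y := by linarith
  have hs2 : 2 ≤ Real.sqrt y := by
    rw [show (2:ℝ) = Real.sqrt 4 by rw [show (4:ℝ) = 2 ^ 2 by norm_num, Real.sqrt_sq (by norm_num)]]
    exact Real.sqrt_le_sqrt hy
  have hs1 : 0 < Real.sqrt y - 1 := by linarith
  have hsy : Real.sqrt y ^ 2 = y := Real.sq_sqrt hy0.le
  set ρ : ℝ := Real.sqrt (y + 4 / (Real.sqrt y - 1)) with hρdef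
  have hadd : 0 ≤ y + 4 / (Real.sqrt y - 1) := by have := div_pos (by norm_num : (0:ℝ) < 4) hs1; linarith
  have hρsq : ρ ^ 2 = y + 4 / (Real.sqrt y - 1) := Real.sq_sqrt hadd
  have hρs : Real.sqrt y ≤ ρ := Real.sqrt_le_sqrt (by linarith [div_pos (by norm_num : (0:ℝ) < 4) hs1])
  have hρ2 : 2 ≤ ρ := hs2.trans hρs
  have hρ0 : 0 < ρ := by linarith
  have hρy : y ≤ ρ ^ 2 := by rw [← hsy]; exact pow_le_pow_left₀ (by linarith) hρs 2
  have hcond : y + 4 * y / (ρ ^ 2 * (ρ - 1)) ≤ ρ ^ 2 := by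
    have h1 : 4 * y / (ρ ^ 2 * (ρ - 1)) ≤ 4 / (ρ - 1) := by
      rw [div_le_div_iff₀ (mul_pos (pow_pos hρ0 2) (by linarith)) (by linarith)]
      nlinarith
    have h2 : 4 / (ρ - 1) ≤ 4 / (Real.sqrt y - 1) := div_le_div_of_nonneg_left (by norm_num) hs1 (by linarith)
    linarith
  have hβ := wallRate_le_of_le_sq hy0 hρ2 hcond
  rw [← hρsq]
  exact pow_le_pow_left₀ (wallRate_pos y).le hβ 2

/-- **THE HALF-PLANE WINDOW `β(y)² ≤ y + 6/y` for every `y ≥ 25`** — the adsorbed phase is entropy-free to order `1/y`: with the tree's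
`√y ≤ β(y)` (`le_wallRate`-type bounds of the S1 files), `y ≤ β(y)² ≤ y + 6/y`. [cite: BeatonBousquetMelouDeGierDuminilCopinGuttmann2014, §3.1 Proposition 5 (arXiv v5 p. 9 l. 16: μ(y) ≥ √y; p. 10 ll. 2–3: "μ(y) ∼ √y", after Rychlewski–Whittington for the square lattice)] -/
theorem wallRate_sq_le_add_six_div (hy : 25 ≤ y) : wallRate y ^ 2 ≤ y + 6 / y := by
  have hy0 : 0 < y := by linarith
  have hs5 : 5 ≤ Real.sqrt y := by
    rw [show (5:ℝ) = Real.sqrt 25 by rw [show (25:ℝ) = 5 ^ 2 by norm_num, Real.sqrt_sq (by norm_num)]]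
    exact Real.sqrt_le_sqrt hy
  have hsy : Real.sqrt y ^ 2 = y := Real.sq_sqrt hy0.le
  set ρ : ℝ := Real.sqrt (y + 6 / y) with hρdef
  have hadd : 0 ≤ y + 6 / y := by positivity
  have hρsq : ρ ^ 2 = y + 6 / y := Real.sq_sqrt hadd
  have hρs : Real.sqrt y ≤ ρ := Real.sqrt_le_sqrt (by linarith [div_pos (by norm_num : (0:ℝ) < 6) hy0])
  have hρ5 : 5 ≤ ρ := hs5.trans hρs
  have hρ2 : 2 ≤ ρ := by linarith
  have hρy : y ≤ ρ ^ 2 := by rw [← hsy]; exact pow_le_pow_left₀ (by linarith) hρs 2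
  have hD : 0 < ρ ^ 3 - ρ - 2 := by nlinarith
  have hcond : y + 4 * y * (ρ + 2) / (ρ ^ 2 * (ρ ^ 3 - ρ - 2)) ≤ ρ ^ 2 := by
    have h1 : 4 * y * (ρ + 2) / (ρ ^ 2 * (ρ ^ 3 - ρ - 2)) ≤ 6 / y := by
      rw [div_le_div_iff₀ (by positivity) hy0]
      have hρ3 : ρ + 2 ≤ (7/5) * ρ := by linarith
      nlinarith [mul_le_mul_of_nonneg_left hρy (by positivity : (0:ℝ) ≤ 4 * y * (ρ + 2)),
        mul_le_mul_of_nonneg_left hρy (by positivity : (0:ℝ) ≤ ρ ^ 2), pow_pos (by linarith : (0:ℝ) < ρ) 2,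
        pow_pos (by linarith : (0:ℝ) < ρ) 3]
    linarith
  have hβ := wallRate_le_of_le_sq' hy0 hρ2 hcond
  rw [← hρsq]
  exact pow_le_pow_left₀ (wallRate_pos y).le hβ 2

/-- `y ≤ β(y)²` (the zig-zag: `1 ≤ B^w_0(y) ≤ β(y)²/y`). [cite: BeatonBousquetMelouDeGierDuminilCopinGuttmann2014, §3.1 Proposition 5 (arXiv v5 p. 9 l. 16: μ(y) ≥ √y, walks sticking to the surface)] -/
theorem le_wallRate_sq (hy : 0 < y) : y ≤ wallRate y ^ 2 := by
  have h1 : (1 : ℝ) ≤ WB 0 y := by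
    have hmem : Zd.straightWalk 2 (2 * 0) ∈ wbr (2 * 0) := straightWalk_mem_wbr 0
    rw [Nat.mul_zero] at hmem
    have := Finset.single_le_sum (f := fun ω => y ^ visits 0 ω) (fun _ _ => pow_nonneg hy.le _) hmem
    simpa [WB] using this
  have h2 := WB_le_pow hy 0
  rw [pow_zero, mul_one] at h2
  have h3 : (1 : ℝ) ≤ wallRate y ^ 2 / y := h1.trans h2
  rwa [le_div_iff₀ hy, one_mul] at h3

/-- **The two-sided half-plane window `y ≤ β(y)² ≤ y + 6/y` for every `y ≥ 25`.** [cite: BeatonBousquetMelouDeGierDuminilCopinGuttmann2014, §3.1 Proposition 5 (arXiv v5 p. 9 l. 16; p. 10 ll. 2–3: "μ(y) ∼ √y")] -/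
theorem wallRate_sq_mem_Icc (hy : 25 ≤ y) : wallRate y ^ 2 ∈ Set.Icc y (y + 6 / y) :=
  ⟨le_wallRate_sq (by linarith), wallRate_sq_le_add_six_div hy⟩

/-! ### §4b The correction is of order exactly `1/y`: `y + 1/(5y) ≤ β(y)²` (the forward excursion of length `6` of `HexSAWSurfaceSqrtStrict.lean`) -/

/-- ★ **`y + 1/(5y) ≤ β(y)²` for every `y ≥ 2`** — with `β(y)² ≤ y + 6/y` (`y ≥ 25`): the first correction to the entropy-free adsorbed phase
is of order EXACTLY `1/y`. [cite: BeatonBousquetMelouDeGierDuminilCopinGuttmann2014, §3.1 Proposition 5 (arXiv v5 p. 9 l. 16; p. 10 ll. 2–3: "μ(y) ∼ √y")] -/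
theorem add_inv_le_wallRate_sq (hy : 2 ≤ y) : y + 1 / (5 * y) ≤ wallRate y ^ 2 := by
  have hy0 : 0 < y := by linarith
  have h8 := pow_add_pow_le_wallRate_pow hy0
  have hβ := (wallRate_pos y).le
  have hle : (y + 1 / (5 * y)) ^ 4 ≤ y ^ 4 + y ^ 2 := by
    have e : (y + 1 / (5 * y)) ^ 4 = y ^ 4 + 4 / 5 * y ^ 2 + 6 / 25 + 4 / (125 * y ^ 2) + 1 / (625 * y ^ 4) := by
      field_simp; ring
    rw [e]
    have h2 : 4 / (125 * y ^ 2) ≤ 4 / 125 := by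
      rw [div_le_div_iff₀ (by positivity) (by norm_num)]; nlinarith
    have h4 : 1 / (625 * y ^ 4) ≤ 1 / 625 := by
      rw [div_le_div_iff₀ (by positivity) (by norm_num)]; nlinarith [pow_le_pow_left₀ (by norm_num : (0:ℝ) ≤ 2) hy 4]
    nlinarith
  have key : (y + 1 / (5 * y)) ^ 4 ≤ (wallRate y ^ 2) ^ 4 := by rw [← pow_mul]; exact hle.trans h8
  exact le_of_pow_le_pow_left₀ (by norm_num) (by positivity) key

/-- **`β(y)² − y ∈ [1/(5y), 6/y]` for every `y ≥ 25`.** [cite: BeatonBousquetMelouDeGierDuminilCopinGuttmann2014, §3.1 Proposition 5 (arXiv v5 pp. 9–10)] -/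
theorem wallRate_sq_sub_mem_Icc (hy : 25 ≤ y) : wallRate y ^ 2 - y ∈ Set.Icc (1 / (5 * y)) (6 / y) := by
  have h1 := add_inv_le_wallRate_sq (by linarith : (2:ℝ) ≤ y)
  have h2 := wallRate_sq_le_add_six_div hy
  constructor <;> linarith

end Wall

/-- **A second attractive wall at distance `T ≥ 3` moves the squared rate by at most `6/y`**: `|μ_T(y,y)² − β(y)²| ≤ 6/y` for every `T ≥ 3`,
`y ≥ 25` (both squares lie in `[y, y + 6/y]`). [cite: BeatonBousquetMelouDeGierDuminilCopinGuttmann2014, §3.1 Proposition 5 and §3.2 Proposition 6 (arXiv v5 pp. 9–10)] -/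
theorem abs_stripMuY₂_self_sq_sub_wallRate_sq_le {T : ℕ} (hT : 3 ≤ T) {y : ℝ} (hy : 25 ≤ y) :
    |stripMuY₂ T y y ^ 2 - Wall.wallRate y ^ 2| ≤ 6 / y := by
  have hy0 : 0 < y := by linarith
  have h1 := stripMuY₂_self_sq_le_of_three_le hT hy
  have h2 : y ≤ stripMuY₂ T y y ^ 2 := by
    have hs := (sqrt_lt_stripMuY₂_self (by omega : 1 ≤ T) (by linarith : (1:ℝ) ≤ y)).le
    have := pow_le_pow_left₀ (Real.sqrt_nonneg y) hs 2
    rwa [Real.sq_sqrt hy0.le] at this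
  obtain ⟨h3, h4⟩ := Wall.wallRate_sq_mem_Icc hy
  rw [abs_le]; constructor <;> linarith

/-! ### §5 Two attractive walls at distance one or two beat the adsorbed half-plane -/

open Literature.Probability.RandomPlanarGeometry.SAW.HV

variable {y : ℝ}

/-- `μ_ℍ < 2` (`μ_ℍ² = 2 + √2 < 4`). [cite: DuminilCopinSmirnov2012, Theorem 1 (μ_ℍ = √(2+√2))] -/
theorem hexConnectiveConstant_lt_two : hexConnectiveConstant < 2 := by
  rw [hexConnectiveConstant_eq_of_thm1 DuminilCopinSmirnov2012_thm1_holds, Real.sqrt_lt' (by norm_num : (0:ℝ) < 2)]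
  have h2 : Real.sqrt 2 < 2 := by
    rw [Real.sqrt_lt' (by norm_num : (0:ℝ) < 2)]; norm_num
  linarith

/-- `μ_ℍ < μ_1(y,y)` for `y ≥ 4` (`μ_ℍ < 2 ≤ √y < μ_1(y,y)`). [cite: BeatonBousquetMelouDeGierDuminilCopinGuttmann2014, §3.2 Proposition 6 (arXiv v5 p. 10); DuminilCopinSmirnov2012, Theorem 1] -/
theorem hexConnectiveConstant_lt_stripMuY₂_self {T : ℕ} (hT : 1 ≤ T) (hy : 4 ≤ y) : hexConnectiveConstant < stripMuY₂ T y y := by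
  have hs2 : 2 ≤ Real.sqrt y := by
    rw [show (2:ℝ) = Real.sqrt 4 by rw [show (4:ℝ) = 2 ^ 2 by norm_num, Real.sqrt_sq (by norm_num)]]
    exact Real.sqrt_le_sqrt hy
  exact hexConnectiveConstant_lt_two.trans_le (hs2.trans (sqrt_lt_stripMuY₂_self hT (by linarith)).le)

/-- ★★ **TWO ATTRACTIVE WALLS AT DISTANCE ONE BEAT THE HALF-PLANE: `μ(y) < μ_1(y,y)` for every `y ≥ 25`** (`μ(y) = max(β(y), μ_ℍ)`;
`β(y)² ≤ y + 6/y ≤ y + 4/(√y−1) <` the width-one switch bound). [cite: BeatonBousquetMelouDeGierDuminilCopinGuttmann2014, §3.1 Proposition 5 (arXiv v5 p. 9: μ(y)) and §3.2 Proposition 6 (p. 10: μ_T(y,z))] -/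
theorem surfaceMu_lt_stripMuY₂_one_self (hy : 25 ≤ y) : surfaceMu y < stripMuY₂ 1 y y := by
  have hy0 : 0 < y := by linarith
  have hy1 : 1 ≤ y := by linarith
  have hs1 : 0 < Real.sqrt y - 1 := by
    have : (5:ℝ) ≤ Real.sqrt y := by
      rw [show (5:ℝ) = Real.sqrt 25 by rw [show (25:ℝ) = 5 ^ 2 by norm_num, Real.sqrt_sq (by norm_num)]]
      exact Real.sqrt_le_sqrt hy
    linarith
  refine max_lt ?_ (hexConnectiveConstant_lt_stripMuY₂_self le_rfl (by linarith))
  -- `β < μ_1`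
  set m : ℕ := ⌊2 * Real.sqrt y⌋₊ + 1 with hm
  have hm1 : 1 ≤ m := by omega
  have hβ0 := (Wall.wallRate_pos y).le
  have hμ1 := (stripMuY₂_pos 1 hy0 hy0).le
  have hA := Wall.wallRate_sq_le_add_six_div hy
  have h64 : y + 6 / y ≤ y + 4 / (Real.sqrt y - 1) := by
    have hsy : Real.sqrt y ^ 2 = y := Real.sq_sqrt hy0.le
    have : 6 / y ≤ 4 / (Real.sqrt y - 1) := by
      rw [div_le_div_iff₀ hy0 hs1]; nlinarith
    linarith
  have hB := mul_pow_le_stripMuY₂_one_self_pow hy1 hm1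
  have hW := windowA_pow_lt hy
  rw [← hm] at hW
  have hc0 : (0 : ℝ) ≤ (m : ℝ) * y ^ (m : ℕ) := by positivity
  have key : Wall.wallRate y ^ (2 * (2 * m + 1)) < stripMuY₂ 1 y y ^ (2 * (2 * m + 1)) := by
    calc Wall.wallRate y ^ (2 * (2 * m + 1)) = (Wall.wallRate y ^ 2) ^ (2 * m + 1) := pow_mul _ _ _
      _ ≤ (y + 4 / (Real.sqrt y - 1)) ^ (2 * m + 1) := pow_le_pow_left₀ (by positivity) (hA.trans h64) _
      _ < (m : ℝ) ^ 2 * y ^ (2 * m) := hW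
      _ = ((m : ℝ) * y ^ (m : ℕ)) ^ 2 := by ring
      _ ≤ (stripMuY₂ 1 y y ^ (2 * m + 1)) ^ 2 := pow_le_pow_left₀ hc0 hB 2
      _ = stripMuY₂ 1 y y ^ (2 * (2 * m + 1)) := by rw [← pow_mul, mul_comm]
  exact lt_of_pow_lt_pow_left₀ _ hμ1 key

/-- ★★ **TWO ATTRACTIVE WALLS AT DISTANCE TWO BEAT THE HALF-PLANE: `μ(y) < μ_2(y,y)` for every `y ≥ 400`** (`β(y)² ≤ y + 6/y <` the
width-two switch bound). [cite: BeatonBousquetMelouDeGierDuminilCopinGuttmann2014, §3.1 Proposition 5 (arXiv v5 p. 9) and §3.2 Proposition 6 (p. 10)] -/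
theorem surfaceMu_lt_stripMuY₂_two_self (hy : 400 ≤ y) : surfaceMu y < stripMuY₂ 2 y y := by
  have hy0 : 0 < y := by linarith
  have hy1 : 1 ≤ y := by linarith
  refine max_lt ?_ (hexConnectiveConstant_lt_stripMuY₂_self (by norm_num) (by linarith))
  set m : ℕ := ⌊3 * y * Real.sqrt y⌋₊ + 1 with hm
  have hm1 : 1 ≤ m := by omega
  have hμ2 := (stripMuY₂_pos 2 hy0 hy0).le
  have hA := Wall.wallRate_sq_le_add_six_div (by linarith : (25:ℝ) ≤ y)
  have hB := mul_pow_le_stripMuY₂_self_pow (T := 2) (by norm_num) hy1 hm1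
  rw [show 2 * m + 2 * 2 - 1 = 2 * m + 3 by omega] at hB
  have hW := windowB_pow_lt hy
  rw [← hm] at hW
  have hc0 : (0 : ℝ) ≤ (m : ℝ) * y ^ (m : ℕ) := by positivity
  have key : Wall.wallRate y ^ (2 * (2 * m + 3)) < stripMuY₂ 2 y y ^ (2 * (2 * m + 3)) := by
    calc Wall.wallRate y ^ (2 * (2 * m + 3)) = (Wall.wallRate y ^ 2) ^ (2 * m + 3) := pow_mul _ _ _
      _ ≤ (y + 6 / y) ^ (2 * m + 3) := pow_le_pow_left₀ (by positivity) hA _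
      _ < (m : ℝ) ^ 2 * y ^ (2 * m) := hW
      _ = ((m : ℝ) * y ^ (m : ℕ)) ^ 2 := by ring
      _ ≤ (stripMuY₂ 2 y y ^ (2 * m + 3)) ^ 2 := pow_le_pow_left₀ hc0 hB 2
      _ = stripMuY₂ 2 y y ^ (2 * (2 * m + 3)) := by rw [← pow_mul, mul_comm]
  exact lt_of_pow_lt_pow_left₀ _ hμ2 key

/-- **The order at the top, completed with the half-plane: `μ(y) < μ_2(y,y) < μ_1(y,y)` for every `y ≥ 400`, and `μ_T(y,y) < μ_2(y,y)` for
every `T ≥ 3`.** [cite: BeatonBousquetMelouDeGierDuminilCopinGuttmann2014, §3.1 Proposition 5 and §3.2 Proposition 6 (arXiv v5 pp. 9–10)] -/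
theorem surfaceMu_lt_two_lt_one (hy : 400 ≤ y) :
    surfaceMu y < stripMuY₂ 2 y y ∧ stripMuY₂ 2 y y < stripMuY₂ 1 y y :=
  ⟨surfaceMu_lt_stripMuY₂_two_self hy, stripMuY₂_self_lt_one le_rfl (by linarith)⟩

end Literature.Probability.RandomPlanarGeometry.SAW.HexBW
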